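import Summits.AtomisticToContinuum.FouriersLaw.Theorems.EmbeddedDrudeMourreGreenKuboContinuationRegularMixing
import Summits.AtomisticToContinuum.FouriersLaw.Theorems.LocalOhmBVLocalOhmStubEquilibriumPackageAux4
import Literature.MathematicalPhysics.KineticTheory.InfiniteChainDLRUniqueness
import HarnessLib

/-!
# Clustering of window observables under the shift-invariant Gibbs state of the pinned chain
(crux `LocalOhmBV.LocalOhm`, item stmt-AtomisticToContinuum-12009, line `registered`/birth; calibration helper NB2
`gibbs_window_cov_tendsto_zero` of the harmonic-corner calibration of the rigidity half)

For `pinnedChain ω₂ lam β γ` (`ω₂ > 0`, `lam, β ≥ 0`), `T > 0` and a shift-invariant DLR Gibbs state `μ`, the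
covariance of a fixed window observable `g ∘ box_{a,n}` with the translates `h ∘ box_{b+w,k}` of another window
observable tends to `0` as `w → +∞` and as `w → -∞` (`g`, `h` continuous of polynomial growth).

Proof: `μ` is THE shift-invariant Gibbs state (`OscillatorChain.pinnedChain_eq_of_isChainGibbsMeasure_of_isShiftInvariant`),
hence the exponentially ρ-mixing transfer-operator state of
`GreenKuboContinuation.TemperatureBlindVitaliHurwitz.exists_regular_state_mixing_pinnedChain`:
`|∫ f₁ f₂ dμ - ∫ f₁ dμ ∫ f₂ dμ| ≤ C e^{-mN} (∫ f₁²)^{1/2} (∫ f₂²)^{1/2}` for `f₁` depending on the sites `≤ p` and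
`f₂` on the sites `≥ p + N`. Window observables of polynomial growth are in `L²(μ)`
(`integrable_comp_boxRestrictAt_of_polyBound` applied to `h²`) with translation-independent second moments
(`integral_comp_boxRestrictAt_eq_anchor_zero`), and for `±w` large the two windows are separated by a gap `≥ N`,
so the covariance is eventually below `|C| e^{-mN} ‖g ∘ box‖₂ ‖h ∘ box‖₂ → 0`. Folklore; no definitions.
-/

set_option autoImplicit false

noncomputable section

namespace Summit.AtomisticToContinuum.FouriersLaw.Theorems.LocalOhmBirth

open MeasureTheory Filter Topology
open scoped BigOperators
open Literature.MathematicalPhysics.KineticTheory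
open Literature.MathematicalPhysics.KineticTheory.HeatConduction

/-- A window observable `h ∘ box_{c,k}` depends only on the sites `c, …, c + k` of its window. -/
theorem dependsOn_comp_boxRestrictAt {α : Type*} (c : ℤ) (k : ℕ) (h : (Fin (k + 1) → ℝ × ℝ) → α) :
    DependsOn (fun σ : ChainConfig => h (boxRestrictAt c k σ)) (Set.Icc c (c + k)) := by
  intro σ σ' hσ
  show h (boxRestrictAt c k σ) = h (boxRestrictAt c k σ')
  congr 1
  funext i
  simp only [boxRestrictAt_apply]
  have hi := i.is_lt
  exact hσ (c + i) (Set.mem_Icc.2 ⟨by omega, by omega⟩)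

/-- `h ∘ box_{c,k}` depends only on the sites `≤ c + k`. -/
theorem dependsOn_comp_boxRestrictAt_le (c : ℤ) (k : ℕ) (h : (Fin (k + 1) → ℝ × ℝ) → ℝ) :
    DependsOn (fun σ : ChainConfig => h (boxRestrictAt c k σ)) {i : ℤ | i ≤ c + k} :=
  (dependsOn_comp_boxRestrictAt c k h).mono fun _ hi => (Set.mem_Icc.1 hi).2

/-- `h ∘ box_{c,k}` depends only on the sites `≥ p` whenever `p ≤ c`. -/
theorem dependsOn_comp_boxRestrictAt_ge (p c : ℤ) (k : ℕ) (h : (Fin (k + 1) → ℝ × ℝ) → ℝ) (hpc : p ≤ c) :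
    DependsOn (fun σ : ChainConfig => h (boxRestrictAt c k σ)) {i : ℤ | p ≤ i} :=
  (dependsOn_comp_boxRestrictAt c k h).mono fun _ hi => hpc.trans (Set.mem_Icc.1 hi).1

/-- Window observables of polynomial growth are square integrable under a shift-invariant Gibbs state of the
pinned chain (`integrable_comp_boxRestrictAt_of_polyBound` for `h²`, again continuous of polynomial growth). -/
theorem memLp_two_comp_boxRestrictAt_of_polyBound {ω₂ lam β : ℝ} (γ : ℝ) (hω : 0 < ω₂) (hl : 0 ≤ lam)
    (hβ : 0 ≤ β) {T : ℝ} (hT : 0 < T) {μ : Measure ChainConfig}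
    (hμ : (pinnedChain ω₂ lam β γ).IsChainGibbsMeasure T μ) (hS : IsShiftInvariant μ) (c : ℤ) (k : ℕ)
    {h : (Fin (k + 1) → ℝ × ℝ) → ℝ} (hh : Continuous h)
    (hb : ∃ (C₀ : ℝ) (m : ℕ), ∀ y, |h y| ≤ C₀ * (1 + ‖y‖) ^ m) :
    MemLp (fun σ => h (boxRestrictAt c k σ)) 2 μ := by
  have hmeas : AEStronglyMeasurable (fun σ => h (boxRestrictAt c k σ)) μ :=
    (hh.measurable.comp (boxRestrictAt_measurable c k)).aestronglyMeasurable
  rw [memLp_two_iff_integrable_sq hmeas]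
  refine integrable_comp_boxRestrictAt_of_polyBound γ hω hl hβ hT hμ hS c k (g := fun y => h y ^ 2)
    (hh.pow 2) ?_
  obtain ⟨C₀, m, hle⟩ := hb
  refine ⟨C₀ ^ 2, 2 * m, fun y => ?_⟩
  show |h y ^ 2| ≤ C₀ ^ 2 * (1 + ‖y‖) ^ (2 * m)
  rw [abs_pow, pow_mul', ← mul_pow]
  exact pow_le_pow_left₀ (abs_nonneg _) (hle y) 2

/-- NB2: **qualitative clustering of the shift-invariant Gibbs state** of the pinned chain (any `lam, β ≥ 0`):
covariances of a fixed window observable with far translates of another window observable tend to zero in both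
directions. The given `μ` is the unique shift-invariant DLR state, hence the exponentially ρ-mixing
transfer-operator state; for `w → +∞` the `h`-window lies to the right of the `g`-window at distance eventually
`≥ N` (half-line mixing with past `{i ≤ a + n}` and future `{i ≥ a + n + N}`), for `w → -∞` to its left (past
`{i ≤ b + w + k}`, future `{i ≥ b + w + k + N} ∋` the `g`-window), and the second moments of the translates of
`h ∘ box` do not depend on the translation. -/
theorem gibbs_window_cov_tendsto_zero :
    ∀ ω₂ lam β γ : ℝ, 0 < ω₂ → 0 ≤ lam → 0 ≤ β → ∀ T : ℝ, 0 < T →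
    ∀ μ : Measure ChainConfig, (pinnedChain ω₂ lam β γ).IsChainGibbsMeasure T μ → IsShiftInvariant μ →
    ∀ (a : ℤ) (n : ℕ) (g : (Fin (n + 1) → ℝ × ℝ) → ℝ), Continuous g →
      (∃ (C₀ : ℝ) (m : ℕ), ∀ y, |g y| ≤ C₀ * (1 + ‖y‖) ^ m) →
    ∀ (b : ℤ) (k : ℕ) (h : (Fin (k + 1) → ℝ × ℝ) → ℝ), Continuous h →
      (∃ (C₀ : ℝ) (m : ℕ), ∀ y, |h y| ≤ C₀ * (1 + ‖y‖) ^ m) →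
    Tendsto (fun w : ℤ => (∫ σ, g (boxRestrictAt a n σ) * h (boxRestrictAt (b + w) k σ) ∂μ) -
        (∫ σ, g (boxRestrictAt a n σ) ∂μ) * (∫ σ, h (boxRestrictAt (b + w) k σ) ∂μ)) atTop (𝓝 0) ∧
    Tendsto (fun w : ℤ => (∫ σ, g (boxRestrictAt a n σ) * h (boxRestrictAt (b + w) k σ) ∂μ) -
        (∫ σ, g (boxRestrictAt a n σ) ∂μ) * (∫ σ, h (boxRestrictAt (b + w) k σ) ∂μ)) atBot (𝓝 0) := by
  intro ω₂ lam β γ hω hl hβ T hT μ hμ hS a n g hg hgb b k h hh hhb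
  -- `μ` is the unique shift-invariant Gibbs state, hence the exponentially ρ-mixing transfer-operator state
  obtain ⟨μ', hμ', hS', -, C, m, hm, hmix⟩ :=
    GreenKuboContinuation.TemperatureBlindVitaliHurwitz.exists_regular_state_mixing_pinnedChain γ hω hl hβ hT
  obtain rfl : μ = μ' :=
    OscillatorChain.pinnedChain_eq_of_isChainGibbsMeasure_of_isShiftInvariant γ hω hl hβ hT hμ hS hμ' hS'
  -- measurability and square integrability of the window observables
  have hGm : Measurable (fun σ => g (boxRestrictAt a n σ)) :=
    hg.measurable.comp (boxRestrictAt_measurable a n)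
  have hHm : ∀ c : ℤ, Measurable (fun σ => h (boxRestrictAt c k σ)) := fun c =>
    hh.measurable.comp (boxRestrictAt_measurable c k)
  have hG2 : MemLp (fun σ => g (boxRestrictAt a n σ)) 2 μ :=
    memLp_two_comp_boxRestrictAt_of_polyBound γ hω hl hβ hT hμ hS a n hg hgb
  have hH2 : ∀ c : ℤ, MemLp (fun σ => h (boxRestrictAt c k σ)) 2 μ := fun c =>
    memLp_two_comp_boxRestrictAt_of_polyBound γ hω hl hβ hT hμ hS c k hh hhb
  -- the second moments of the translates of `h ∘ box` do not depend on the translation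
  have hBc : ∀ c : ℤ, (∫ σ, h (boxRestrictAt c k σ) ^ 2 ∂μ) ^ (1 / 2 : ℝ) =
      (∫ σ, h (boxRestrictAt 0 k σ) ^ 2 ∂μ) ^ (1 / 2 : ℝ) := fun c => by
    have e : ∫ σ, h (boxRestrictAt c k σ) ^ 2 ∂μ = ∫ σ, h (boxRestrictAt 0 k σ) ^ 2 ∂μ :=
      integral_comp_boxRestrictAt_eq_anchor_zero hS c k (g := fun y => h y ^ 2) (hh.measurable.pow_const 2)
    rw [e]
  set A : ℝ := (∫ σ, g (boxRestrictAt a n σ) ^ 2 ∂μ) ^ (1 / 2 : ℝ)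
  set B : ℝ := (∫ σ, h (boxRestrictAt 0 k σ) ^ 2 ∂μ) ^ (1 / 2 : ℝ)
  have hA0 : 0 ≤ A := Real.rpow_nonneg (integral_nonneg fun _ => sq_nonneg _) _
  have hB0 : 0 ≤ B := Real.rpow_nonneg (integral_nonneg fun _ => sq_nonneg _) _
  -- the rate `|C| e^{-mN} A B` is eventually below any `ε > 0`
  have hrate : ∀ ε : ℝ, 0 < ε → ∃ N : ℕ, |C| * Real.exp (-(m * N)) * A * B < ε := by
    intro ε hε
    have hexp : Tendsto (fun N : ℕ => Real.exp (-(m * N))) atTop (𝓝 0) :=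
      Real.tendsto_exp_atBot.comp (tendsto_neg_atTop_atBot.comp
        ((tendsto_natCast_atTop_atTop (R := ℝ)).const_mul_atTop hm))
    have ht := ((hexp.const_mul |C|).mul_const A).mul_const B
    rw [mul_zero, zero_mul, zero_mul] at ht
    exact (ht.eventually (gt_mem_nhds hε)).exists
  have hCle : ∀ (N : ℕ) (x y : ℝ), 0 ≤ x → 0 ≤ y →
      C * Real.exp (-(m * N)) * x * y ≤ |C| * Real.exp (-(m * N)) * x * y := fun N x y hx hy =>
    mul_le_mul_of_nonneg_right (mul_le_mul_of_nonneg_right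
      (mul_le_mul_of_nonneg_right (le_abs_self C) (Real.exp_pos _).le) hx) hy
  refine ⟨Metric.tendsto_nhds.2 fun ε hε => ?_, Metric.tendsto_nhds.2 fun ε hε => ?_⟩
  · -- `w → +∞`: the `h`-window lies at distance `≥ N` to the right of the `g`-window
    obtain ⟨N, hN⟩ := hrate ε hε
    refine eventually_atTop.2 ⟨a + n + N - b, fun w hw => ?_⟩
    rw [Real.dist_0_eq_abs]
    have hdg : DependsOn (fun σ : ChainConfig => g (boxRestrictAt a n σ)) {i : ℤ | i ≤ a + n} :=
      dependsOn_comp_boxRestrictAt_le a n g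
    have hdh : DependsOn (fun σ : ChainConfig => h (boxRestrictAt (b + w) k σ)) {i : ℤ | a + n + N ≤ i} :=
      dependsOn_comp_boxRestrictAt_ge (a + n + N) (b + w) k h (by omega)
    calc |(∫ σ, g (boxRestrictAt a n σ) * h (boxRestrictAt (b + w) k σ) ∂μ) -
          (∫ σ, g (boxRestrictAt a n σ) ∂μ) * (∫ σ, h (boxRestrictAt (b + w) k σ) ∂μ)|
        ≤ C * Real.exp (-(m * N)) * A * (∫ σ, h (boxRestrictAt (b + w) k σ) ^ 2 ∂μ) ^ (1 / 2 : ℝ) :=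
          hmix (a + n) N _ _ hdg hdh hGm (hHm _) hG2 (hH2 _)
      _ = C * Real.exp (-(m * N)) * A * B := by rw [hBc]
      _ ≤ |C| * Real.exp (-(m * N)) * A * B := hCle N A B hA0 hB0
      _ < ε := hN
  · -- `w → -∞`: the `h`-window lies at distance `≥ N` to the left of the `g`-window
    obtain ⟨N, hN⟩ := hrate ε hε
    refine eventually_atBot.2 ⟨a - N - k - b, fun w hw => ?_⟩
    rw [Real.dist_0_eq_abs]
    have hdh : DependsOn (fun σ : ChainConfig => h (boxRestrictAt (b + w) k σ)) {i : ℤ | i ≤ b + w + k} :=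
      dependsOn_comp_boxRestrictAt_le (b + w) k h
    have hdg : DependsOn (fun σ : ChainConfig => g (boxRestrictAt a n σ)) {i : ℤ | b + w + k + N ≤ i} :=
      dependsOn_comp_boxRestrictAt_ge (b + w + k + N) a n g (by omega)
    have hcomm : (∫ σ, g (boxRestrictAt a n σ) * h (boxRestrictAt (b + w) k σ) ∂μ) -
          (∫ σ, g (boxRestrictAt a n σ) ∂μ) * (∫ σ, h (boxRestrictAt (b + w) k σ) ∂μ) =
        (∫ σ, h (boxRestrictAt (b + w) k σ) * g (boxRestrictAt a n σ) ∂μ) -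
          (∫ σ, h (boxRestrictAt (b + w) k σ) ∂μ) * (∫ σ, g (boxRestrictAt a n σ) ∂μ) := by
      rw [mul_comm (∫ σ, g (boxRestrictAt a n σ) ∂μ)]
      congr 1
      exact integral_congr_ae (Eventually.of_forall fun σ => mul_comm _ _)
    rw [hcomm]
    calc |(∫ σ, h (boxRestrictAt (b + w) k σ) * g (boxRestrictAt a n σ) ∂μ) -
          (∫ σ, h (boxRestrictAt (b + w) k σ) ∂μ) * (∫ σ, g (boxRestrictAt a n σ) ∂μ)|
        ≤ C * Real.exp (-(m * N)) * (∫ σ, h (boxRestrictAt (b + w) k σ) ^ 2 ∂μ) ^ (1 / 2 : ℝ) * A :=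
          hmix (b + w + k) N _ _ hdh hdg (hHm _) hGm (hH2 _) hG2
      _ = C * Real.exp (-(m * N)) * B * A := by rw [hBc]
      _ ≤ |C| * Real.exp (-(m * N)) * B * A := hCle N B A hB0 hA0
      _ = |C| * Real.exp (-(m * N)) * A * B := by ring
      _ < ε := hN

end Summit.AtomisticToContinuum.FouriersLaw.Theorems.LocalOhmBirth

end
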